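import Literature.Probability.LatticeModels.PlanarIsingHalfPlaneSpinorUniqueness
import Literature.Analysis.Complex.RiemannMapping
import Literature.Analysis.Complex.InjectiveHolomorphic
import Mathlib.Analysis.Complex.HasPrimitives
import Mathlib.Analysis.Calculus.Deriv.Shift
import Mathlib.MeasureTheory.Integral.IntervalIntegral.FundThmCalculus
import HarnessLib

/-!
# Uniqueness of CHI's spinor boundary value problem on a simply connected domain (Prop. 3.9 ⇒ Remark 2.9), squared form

Topic `Literature/Probability/LatticeModels`. Chelkak–Hongler–Izyurov, Ann. of Math. 181 (2015) =
arXiv:1202.2838v2 ("CHI15"), Prop. 3.9 with Remark 2.9: the continuum spinor `f_{[Ω,a;b]}` of an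
arbitrary simply connected `Ω` is *defined* by conformal covariance from a smooth domain (Remark 2.9
(ii), the tree's `domainSpinorSq φ a b = f_{[ℍ,φa;φb]}² ∘ φ · φ'`, `PlanarIsingDomainSpinor.lean`), the
properties (1)–(4) of its primitive `h = Re ∫ f²` "are preserved under conformal mappings too"
(proof of Prop. 3.9), and the identification of subsequential limits of the discrete spinors (§3.4,
proof of Thm 2.16, the input of Thms 2.18/2.20 = the named facts `chi_plusTwoPoint_*`,
`chi_freePlusTwoPoint_ratio`) is "the uniqueness proven in Remark 2.9 (i)".

This file transports the half-plane theorem `eqOn_spinorSqCHI_of_bvp`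
(`PlanarIsingHalfPlaneSpinorUniqueness.lean`) along a conformal bijection `φ : Ω → ℍ`:
**`eqOn_domainSpinorSq_of_bvp`** — a holomorphic `q` on `Ω ∖ {a,b}`, locally a square, branching at
`b`, whose single-valued primitive `h` (`dh = Re(q dz)`) tends to `0` at `∂Ω` (off compacts of `Ω`),
takes a value `≤ 0` in every boundary half-disc `φ⁻¹({|w-x₀|<r} ∩ ℍ)` (the prime-end form of
Prop. 3.9 (2)), is bounded below near `b` and has `(z-a)q(z) → 1`, equals `f_{[Ω,a;b]}²`. The
transported data are `q^ψ = (q ∘ ψ)·ψ'`, `h^ψ = h ∘ ψ` for `ψ = φ⁻¹` (holomorphic: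
`Complex.hasStrictDerivAt_invFunOn`); local square roots of `ψ'` and of `(w-φb)ψ'(w)/(ψ w - b)`
carry the spinor structure (`exists_ball_sq_eq_of_ne_zero`). Corollaries read off the coefficients
CHI's Thms 2.18/2.20 consume: `(z-b)q → -𝓑_Ω(a;b)²` (`tendsto_mul_sub_right_of_bvp`) and the
regular part `𝒜_Ω(a;b)` at `a` (`tendsto_slope_mul_sub_left_of_bvp`); `tendsto_one_of_re_primitive_bounded`
is Prop. 3.9's "(3),(4) imply (2.8)" (the normalisation from the boundedness of `h^{(a)}`;
packaged with the main theorem as `eqOn_domainSpinorSq_of_bvp_of_bounded`), and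
`eqOn_zero_of_bvp_bounded` the renormalised case of §3.4 (`h` bounded near `a` forces `h ≡ 0`).
The interface lemma `hasFDerivAt_reMul_of_staircase` produces the hypothesis `dh = Re(q dz)` from
the staircase increments `h(w) - h(p) = Re(∫ horizontal + i ∫ vertical)` with ordered corners, the
form in which the lattice primitives `H_δ` pass to the limit (`LatticeToContinuumPrimitive.lean`,
§3.5). Everything is proved; no named fact.

## References

* D. Chelkak, C. Hongler, K. Izyurov, Ann. of Math. (2) 181 (2015) 1087–1138 = arXiv:1202.2838v2:
  Remark 2.9 (i)–(ii), Prop. 3.9 (and its proof: conformal invariance of (1)–(4)), §3.4.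
  [ChelkakHonglerIzyurovAnnals2015]
-/

noncomputable section

open Filter Topology Metric Set Real Complex
open scoped ComplexConjugate
open Literature.Probability.LatticeModels

namespace Literature.Probability.LatticeModels

/-! ### Local holomorphic square roots of a non-vanishing holomorphic function -/

/-- Near a point where a holomorphic `F` does not vanish it has a holomorphic square root (the
principal branch of `(F/F(w₀))^{1/2}`). [folklore] -/
theorem exists_ball_sq_eq_of_ne_zero {F : ℂ → ℂ} {U : Set ℂ} (hU : IsOpen U) (hF : DifferentiableOn ℂ F U)
    {w₀ : ℂ} (hw₀ : w₀ ∈ U) (h0 : F w₀ ≠ 0) :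
    ∃ ε > 0, ball w₀ ε ⊆ U ∧ ∃ s : ℂ → ℂ, DifferentiableOn ℂ s (ball w₀ ε) ∧ ∀ w ∈ ball w₀ ε, s w ^ 2 = F w := by
  have hcont : ContinuousAt F w₀ := (hF.differentiableAt (hU.mem_nhds hw₀)).continuousAt
  have hev : ∀ᶠ w in 𝓝 w₀, ‖F w / F w₀ - 1‖ < 1 ∧ w ∈ U := by
    refine Eventually.and ?_ (hU.mem_nhds hw₀)
    have ht : Tendsto (fun w => F w / F w₀ - 1) (𝓝 w₀) (𝓝 0) := by
      have := (hcont.tendsto.div_const (F w₀)).sub_const 1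
      rwa [div_self h0, sub_self] at this
    have := tendsto_zero_iff_norm_tendsto_zero.1 ht
    exact (this.eventually (Iio_mem_nhds one_pos)).mono fun w hw => hw
  obtain ⟨ε, hε, hball⟩ := Metric.eventually_nhds_iff_ball.1 hev
  refine ⟨ε, hε, fun w hw => (hball w hw).2,
    fun w => (F w₀) ^ ((2 : ℂ)⁻¹) * (F w / F w₀) ^ ((2 : ℂ)⁻¹), ?_, ?_⟩
  · intro w hw
    have hslit : F w / F w₀ ∈ slitPlane := by
      have := mem_slitPlane_of_norm_lt_one (hball w hw).1
      rwa [add_sub_cancel] at this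
    have hFw : DifferentiableAt ℂ F w := hF.differentiableAt (hU.mem_nhds (hball w hw).2)
    exact ((differentiableAt_const _).mul ((hFw.div_const _).cpow (differentiableAt_const _) hslit)).differentiableWithinAt
  · intro w _
    rw [mul_pow, cpow_two_inv_sq, cpow_two_inv_sq]
    field_simp

/-! ### The inverse chart -/

/-! ### From staircase (wedge) increments to the differential `dh = Re(q dz)` -/

/-- `|x - c| < R` on `[[a, b]]` once it holds at the endpoints. [folklore] -/
theorem abs_sub_lt_of_mem_uIcc {a b c x R : ℝ} (ha : |a - c| < R) (hb : |b - c| < R)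
    (hx : x ∈ uIcc a b) : |x - c| < R := by
  rw [abs_lt] at ha hb ⊢
  rcases Set.mem_uIcc.1 hx with ⟨h1, h2⟩ | ⟨h1, h2⟩ <;> constructor <;> linarith

/-- A point whose coordinates are within `r/2` of those of `z` lies in `B(z, r)`. [folklore] -/
theorem mem_ball_of_abs_re_lt_of_abs_im_lt {ζ z : ℂ} {r : ℝ} (hre : |ζ.re - z.re| < r / 2)
    (him : |ζ.im - z.im| < r / 2) : ζ ∈ ball z r := by
  rw [mem_ball, dist_eq_norm]
  have h := Complex.norm_le_abs_re_add_abs_im (ζ - z)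
  rw [Complex.sub_re, Complex.sub_im] at h
  linarith

/-- Coordinates of a point of `B(z, s)` are within `s` of those of `z`. [folklore] -/
theorem abs_re_im_lt_of_mem_ball {p z : ℂ} {s : ℝ} (hp : p ∈ ball z s) :
    |p.re - z.re| < s ∧ |p.im - z.im| < s := by
  rw [mem_ball, dist_eq_norm] at hp
  have h1 := abs_re_le_norm (p - z)
  have h2 := abs_im_le_norm (p - z)
  rw [Complex.sub_re] at h1
  rw [Complex.sub_im] at h2
  exact ⟨h1.trans_lt hp, h2.trans_lt hp⟩

/-- **The staircase integral of a function with a primitive.** If `Q' = q` on `B(z, r)` (with `q`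
continuous there) then for `p, w ∈ B(z, r/2)` the staircase integral — horizontal leg at height
`Im p`, then vertical leg at abscissa `Re w` (Mathlib's `Complex.wedgeIntegral p w q`) — equals
`Q w - Q p`. [folklore] -/
theorem wedge_eq_sub_of_hasDerivAt {q Q : ℂ → ℂ} {z : ℂ} {r : ℝ}
    (hQ : ∀ x ∈ ball z r, HasDerivAt Q (q x) x) (hqc : ContinuousOn q (ball z r))
    {p w : ℂ} (hp : p ∈ ball z (r / 2)) (hw : w ∈ ball z (r / 2)) :
    ((∫ x in p.re..w.re, q (x + p.im * I)) + I * ∫ y in p.im..w.im, q (w.re + y * I)) = Q w - Q p := by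
  obtain ⟨hp1, hp2⟩ := abs_re_im_lt_of_mem_ball hp
  obtain ⟨hw1, hw2⟩ := abs_re_im_lt_of_mem_ball hw
  have hH : ∀ x ∈ uIcc p.re w.re, (x : ℂ) + p.im * I ∈ ball z r := fun x hx =>
    mem_ball_of_abs_re_lt_of_abs_im_lt (by simpa using abs_sub_lt_of_mem_uIcc hp1 hw1 hx)
      (by simpa using hp2)
  have hV : ∀ y ∈ uIcc p.im w.im, (w.re : ℂ) + y * I ∈ ball z r := fun y hy =>
    mem_ball_of_abs_re_lt_of_abs_im_lt (by simpa using hw1)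
      (by simpa using abs_sub_lt_of_mem_uIcc hp2 hw2 hy)
  have hHimg : (fun x : ℝ => (x : ℂ) + p.im * I) '' uIcc p.re w.re ⊆ ball z r := by
    rintro _ ⟨x, hx, rfl⟩; exact hH x hx
  have hVimg : (fun y : ℝ => (w.re : ℂ) + y * I) '' uIcc p.im w.im ⊆ ball z r := by
    rintro _ ⟨y, hy, rfl⟩; exact hV y hy
  -- horizontal leg
  have hderH : ∀ x ∈ uIcc p.re w.re,
      HasDerivAt (fun x : ℝ => Q (x + p.im * I)) (q (x + p.im * I)) x := by
    intro x hx
    have e : HasDerivAt (fun ζ : ℂ => Q (ζ + p.im * I)) (q (x + p.im * I)) (x : ℂ) :=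
      HasDerivAt.comp_add_const (x : ℂ) (p.im * I) (hQ _ (hH x hx))
    exact e.comp_ofReal
  have hintH : IntervalIntegrable (fun x : ℝ => q (x + p.im * I)) MeasureTheory.volume p.re w.re :=
    ((hqc.mono hHimg).comp (by fun_prop) (mapsTo_image _ _)).intervalIntegrable
  have eH := intervalIntegral.integral_eq_sub_of_hasDerivAt hderH hintH
  -- vertical leg
  have hderV : ∀ y ∈ uIcc p.im w.im,
      HasDerivAt (fun y : ℝ => Q (w.re + y * I)) (q (w.re + y * I) * I) y := by
    intro y hy
    have e1 : HasDerivAt (fun ζ : ℂ => (w.re : ℂ) + ζ * I) I (y : ℂ) := by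
      simpa using ((hasDerivAt_id (y : ℂ)).mul_const I).const_add (w.re : ℂ)
    exact ((hQ _ (hV y hy)).comp (y : ℂ) e1).comp_ofReal
  have hintV : IntervalIntegrable (fun y : ℝ => q (w.re + y * I) * I) MeasureTheory.volume p.im w.im :=
    (((hqc.mono hVimg).comp (by fun_prop) (mapsTo_image _ _)).mul continuousOn_const).intervalIntegrable
  have eV := intervalIntegral.integral_eq_sub_of_hasDerivAt hderV hintV
  rw [intervalIntegral.integral_mul_const] at eV
  rw [eH, mul_comm I, eV, Complex.re_add_im p, Complex.re_add_im w]
  ring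

/-- **`dh = Re(q dz)` from staircase increments.** If `q` is holomorphic on `U` and the increments
of a real function `h` over the lattice-type staircases (horizontal leg, then vertical leg) with
ORDERED corners `Re p ≤ Re w`, `Im p ≤ Im w` in small balls of `U` are
`Re(∫_{Re p}^{Re w} q(x + i Im p) dx + i ∫_{Im p}^{Im w} q(Re w + iy) dy)` — the form in which the
lattice primitives `H_δ = Re ∫^δ F_δ²` pass to the limit (`tendsto_staircase_of_increments`,
`LatticeToContinuumPrimitive.lean`; CHI15 §3.5: "`H_δ → h̃ := Re ∫ f̃²` uniformly on compact
subsets") — then `h` has the differential `v ↦ Re(q(z) v)` at every point of `U`: hypothesis `hh`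
of `eqOn_domainSpinorSq_of_bvp` / `eqOn_zero_of_bvp_bounded`. (Via a local primitive `Q` of `q`:
`h = Re Q + const` on small balls, comparing both corners with their south-west corner.)
[cite: ChelkakHonglerIzyurovAnnals2015, §3.5 (proof of Thm 2.16: H_δ → Re ∫ f̃²)] -/
theorem hasFDerivAt_reMul_of_staircase {U : Set ℂ} {q : ℂ → ℂ} (hq : DifferentiableOn ℂ q U)
    {h : ℂ → ℝ}
    (hst : ∀ z ∈ U, ∃ r > 0, ball z r ⊆ U ∧ ∀ p ∈ ball z r, ∀ w ∈ ball z r, p.re ≤ w.re → p.im ≤ w.im →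
      h w - h p = ((∫ x in p.re..w.re, q (x + p.im * I)) + I * ∫ y in p.im..w.im, q (w.re + y * I)).re)
    {z : ℂ} (hz : z ∈ U) : HasFDerivAt h (reMul (q z)) z := by
  obtain ⟨r, hr, hballU, hformula⟩ := hst z hz
  obtain ⟨Q, hQ⟩ := (hq.mono hballU).isExactOn_ball
  have hqc : ContinuousOn q (ball z r) := (hq.mono hballU).continuousOn
  have hRe : ∀ p ∈ ball z (r / 2), ∀ w ∈ ball z (r / 2), p.re ≤ w.re → p.im ≤ w.im →
      h w - h p = (Q w - Q p).re := by
    intro p hp w hw hre him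
    have hr2 : r / 2 ≤ r := by linarith
    rw [hformula p (ball_subset_ball hr2 hp) w (ball_subset_ball hr2 hw) hre him,
      wedge_eq_sub_of_hasDerivAt hQ hqc hp hw]
  -- all points of `B(z, r/4)`, via the south-west corner of `{z, w}`
  have hall : ∀ w ∈ ball z (r / 4), h w - h z = (Q w - Q z).re := by
    intro w hw
    obtain ⟨hw1, hw2⟩ := abs_re_im_lt_of_mem_ball hw
    obtain ⟨m, hmre, hmim⟩ : ∃ m : ℂ, m.re = min z.re w.re ∧ m.im = min z.im w.im := ⟨⟨_, _⟩, rfl, rfl⟩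
    have hm2 : m ∈ ball z (r / 2) := by
      refine mem_ball_of_abs_re_lt_of_abs_im_lt ?_ ?_
      · rw [hmre]
        rcases min_cases z.re w.re with ⟨h1, -⟩ | ⟨h1, -⟩ <;> rw [h1]
        · rw [sub_self, abs_zero]; positivity
        · linarith
      · rw [hmim]
        rcases min_cases z.im w.im with ⟨h1, -⟩ | ⟨h1, -⟩ <;> rw [h1]
        · rw [sub_self, abs_zero]; positivity
        · linarith
    have hz2 : z ∈ ball z (r / 2) := mem_ball_self (by positivity)
    have hw2' : w ∈ ball z (r / 2) := ball_subset_ball (by linarith) hw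
    have e1 := hRe m hm2 z hz2 (by rw [hmre]; exact min_le_left _ _) (by rw [hmim]; exact min_le_left _ _)
    have e2 := hRe m hm2 w hw2' (by rw [hmre]; exact min_le_right _ _) (by rw [hmim]; exact min_le_right _ _)
    simp only [Complex.sub_re] at e1 e2 ⊢
    linarith
  have heq : h =ᶠ[𝓝 z] fun w => (Q w).re + (h z - (Q z).re) := by
    filter_upwards [ball_mem_nhds z (by positivity : (0 : ℝ) < r / 4)] with w hw
    have := hall w hw
    simp only [Complex.sub_re] at this
    linarith
  have hmodel : HasFDerivAt (fun w => (Q w).re + (h z - (Q z).re)) (reMul (q z)) z := by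
    have e1 : HasFDerivAt (fun w => (Q w).re)
        (reCLM.comp ((ContinuousLinearMap.smulRight (1 : ℂ →L[ℂ] ℂ) (q z)).restrictScalars ℝ)) z :=
      reCLM.hasFDerivAt.comp z ((hQ z (mem_ball_self hr)).hasFDerivAt.restrictScalars ℝ)
    refine (e1.add_const (h z - (Q z).re)).congr_fderiv (ContinuousLinearMap.ext fun v => ?_)
    simp [reMul_apply, mul_comm]
  exact hmodel.congr_of_eventuallyEq heq

section Transport

variable {Ω : Set ℂ} {φ : ℂ → ℂ} {a b : ℂ}

/-- The inverse `ψ = φ⁻¹ : ℍ → Ω` of a conformal bijection of an open set onto `ℍ`: a bijection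
`ℍ → Ω` inverting `φ`, holomorphic with `ψ'(φ z) = φ'(z)⁻¹ ≠ 0`. [folklore] -/
theorem invFunOn_conformal (hΩ : IsOpen Ω) (hφ : IsConformalBijection φ Ω UpperHalfPlane.upperHalfPlaneSet) :
    BijOn (Function.invFunOn φ Ω) UpperHalfPlane.upperHalfPlaneSet Ω ∧
      (∀ z ∈ Ω, Function.invFunOn φ Ω (φ z) = z) ∧
      (∀ w ∈ UpperHalfPlane.upperHalfPlaneSet, φ (Function.invFunOn φ Ω w) = w) ∧
      (∀ z ∈ Ω, deriv φ z ≠ 0) ∧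
      ∀ z ∈ Ω, HasDerivAt (Function.invFunOn φ Ω) (deriv φ z)⁻¹ (φ z) := by
  have hbij := hφ.2
  have hinv := hbij.invOn_invFunOn
  have hder : ∀ z ∈ Ω, deriv φ z ≠ 0 := fun z hz =>
    Literature.Analysis.Complex.SCV.deriv_ne_zero_of_injOn hφ.1 hΩ hbij.injOn hz
  refine ⟨hbij.symm hinv.symm, fun z hz => hinv.1 hz, fun w hw => hinv.2 hw, hder, fun z hz => ?_⟩
  exact (Complex.hasStrictDerivAt_invFunOn hΩ hφ.1 hbij.injOn hder hz).hasDerivAt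

/-- **Uniqueness of the spinor boundary value problem on a simply connected domain (CHI15 Prop. 3.9
& Remark 2.9, `k = 1`, squared form, conformally transported).** Let `φ : Ω → ℍ` be a conformal
bijection of the open set `Ω`, `a ≠ b` in `Ω`, and let `q` be holomorphic on `Ω ∖ {a,b}`, locally a
square of a holomorphic function, with `(z-b)q(z)` a square of a holomorphic function on a punctured
neighbourhood of `b`; let `h : ℂ → ℝ` have `dh = Re(q dz)` on `Ω ∖ {a,b}` and satisfy
(1) `h → 0` at `∂Ω`: `|h| < ε` on `Ω` off a compact subset of `Ω`;
(2) for every `x₀ ∈ ℝ = ∂ℍ` and `r > 0` some `z ∈ Ω` with `|φ z - x₀| < r` has `h z ≤ 0` (no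
    boundary point, in the sense of prime ends, near which `h > 0` — the one-sided form of
    "`∂_ν h ≥ 0`" delivered by Chelkak–Smirnov's Remark 6.3);
(3) `h` is bounded below near `b`; (4) `(z-a) q(z) → 1` as `z → a`.
Then `q = f_{[Ω,a;b]}² = domainSpinorSq φ a b` on `Ω ∖ {a,b}` — so that, in particular, the
coefficients read off at `a` and `b` are `𝒜_Ω(a;b) = ACHI φ a b` and `𝓑_Ω(a;b) = bCHI (φ a) (φ b)`
(`PlanarIsingDomainSpinor.lean`). [cite: ChelkakHonglerIzyurovAnnals2015, Prop. 3.9 with Remark 2.9 (i)–(ii); §3.4 (proof of Thm 2.16: identification of the limit)] -/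
theorem eqOn_domainSpinorSq_of_bvp (hΩ : IsOpen Ω)
    (hφ : IsConformalBijection φ Ω UpperHalfPlane.upperHalfPlaneSet) (ha : a ∈ Ω) (hb : b ∈ Ω) (hab : a ≠ b)
    {q : ℂ → ℂ} {h : ℂ → ℝ}
    (hq : DifferentiableOn ℂ q (Ω \ {a, b}))
    (hsq : ∀ z ∈ Ω \ {a, b}, ∃ ε > 0, ∃ g : ℂ → ℂ, DifferentiableOn ℂ g (ball z ε) ∧ ∀ w ∈ ball z ε, q w = g w ^ 2)
    (hsqb : ∃ ε > 0, ∃ k : ℂ → ℂ, DifferentiableOn ℂ k (ball b ε \ {b}) ∧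
      ∀ w ∈ ball b ε \ {b}, (w - b) * q w = k w ^ 2)
    (hh : ∀ z ∈ Ω \ {a, b}, HasFDerivAt h (reMul (q z)) z)
    (h1 : ∀ ε > 0, ∃ K ⊆ Ω, IsCompact K ∧ ∀ z ∈ Ω \ K, |h z| < ε)
    (h2 : ∀ (x₀ : ℝ) (r : ℝ), 0 < r → ∃ z ∈ Ω, dist (φ z) x₀ < r ∧ h z ≤ 0)
    (h3 : ∃ r > 0, ∃ M : ℝ, ∀ z ∈ ball b r \ {b}, z ∈ Ω → M ≤ h z)
    (h4 : Tendsto (fun z => (z - a) * q z) (𝓝[≠] a) (𝓝 1)) :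
    EqOn q (domainSpinorSq φ a b) (Ω \ {a, b}) := by
  set H : Set ℂ := UpperHalfPlane.upperHalfPlaneSet with hHdef
  have hHo : IsOpen H := UpperHalfPlane.isOpen_upperHalfPlaneSet
  obtain ⟨hbijψ, hψφ, hφψ, hder, hψder⟩ := invFunOn_conformal hΩ hφ
  set ψ : ℂ → ℂ := Function.invFunOn φ Ω with hψdef
  have hφan : AnalyticOnNhd ℂ φ Ω := hφ.1.analyticOnNhd hΩ
  have hψH : ∀ w ∈ H, ψ w ∈ Ω := fun w hw => hbijψ.mapsTo hw
  have hφΩ : ∀ z ∈ Ω, φ z ∈ H := fun z hz => hφ.2.mapsTo hz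
  have hψd : ∀ w ∈ H, HasDerivAt ψ (deriv φ (ψ w))⁻¹ w := fun w hw => by
    have := hψder (ψ w) (hψH w hw)
    rwa [hφψ w hw] at this
  have hψdiff : DifferentiableOn ℂ ψ H := fun w hw => (hψd w hw).differentiableAt.differentiableWithinAt
  have hψan : AnalyticOnNhd ℂ ψ H := hψdiff.analyticOnNhd hHo
  have hψ' : ∀ w ∈ H, deriv ψ w = (deriv φ (ψ w))⁻¹ := fun w hw => (hψd w hw).deriv
  have hψ'0 : ∀ w ∈ H, deriv ψ w ≠ 0 := fun w hw => by
    rw [hψ' w hw]; exact inv_ne_zero (hder _ (hψH w hw))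
  have hψ'd : DifferentiableOn ℂ (deriv ψ) H := (hψan.deriv).differentiableOn
  have hψinj : InjOn ψ H := hbijψ.injOn
  set a' : ℂ := φ a with ha'
  set b' : ℂ := φ b with hb'
  have ha'H : a' ∈ H := hφΩ a ha
  have hb'H : b' ∈ H := hφΩ b hb
  have ha'im : 0 < a'.im := ha'H
  have hb'im : 0 < b'.im := hb'H
  have hab' : a' ≠ b' := fun h => hab (hφ.2.injOn ha hb h)
  have hψa : ψ a' = a := hψφ a ha
  have hψb : ψ b' = b := hψφ b hb
  -- `ψ` maps `ℍ ∖ {a',b'}` into `Ω ∖ {a,b}`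
  have hψD : ∀ w ∈ H \ {a', b'}, ψ w ∈ Ω \ {a, b} := by
    intro w hw
    have hwH : w ∈ H := hw.1
    have hne : w ≠ a' ∧ w ≠ b' := by simpa [not_or] using hw.2
    refine ⟨hψH w hwH, ?_⟩
    simp only [mem_insert_iff, mem_singleton_iff, not_or]
    refine ⟨fun h => hne.1 ?_, fun h => hne.2 ?_⟩
    · rw [← hφψ w hwH, h]
    · rw [← hφψ w hwH, h]
  -- the transported data
  set q' : ℂ → ℂ := fun w => q (ψ w) * deriv ψ w with hq'def
  set h' : ℂ → ℝ := fun w => h (ψ w) with hh'def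
  /- (hq') -/
  have hq'd : DifferentiableOn ℂ q' (H \ {a', b'}) := by
    intro w hw
    have hwH : w ∈ H := hw.1
    have hzD := hψD w hw
    have hΩo : IsOpen (Ω \ {a, b}) := hΩ.sdiff (Set.toFinite {a, b}).isClosed
    have e1 : DifferentiableAt ℂ (fun w => q (ψ w)) w :=
      (hq.differentiableAt (hΩo.mem_nhds hzD)).comp w (hψdiff.differentiableAt (hHo.mem_nhds hwH))
    exact (e1.mul (hψ'd.differentiableAt (hHo.mem_nhds hwH))).differentiableWithinAt
  /- (hsq') local squares -/
  have hsq' : ∀ w ∈ H \ {a', b'}, ∃ ε > 0, ∃ g : ℂ → ℂ,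
      DifferentiableOn ℂ g (ball w ε) ∧ ∀ v ∈ ball w ε, q' v = g v ^ 2 := by
    intro w₀ hw₀
    have hw₀H : w₀ ∈ H := hw₀.1
    have hz₀ := hψD w₀ hw₀
    obtain ⟨ε, hε, g, hgd, hg⟩ := hsq (ψ w₀) hz₀
    -- square root of `ψ'` near `w₀`
    obtain ⟨ε₁, hε₁, hball₁, s, hsd, hs⟩ := exists_ball_sq_eq_of_ne_zero hHo hψ'd hw₀H (hψ'0 w₀ hw₀H)
    -- `ψ` maps a small ball into `ball (ψ w₀) ε`
    obtain ⟨δ, hδ, hδψ⟩ := Metric.continuousAt_iff.1 (hψdiff.differentiableAt (hHo.mem_nhds hw₀H)).continuousAt ε hε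
    set ε' : ℝ := min ε₁ δ with hε'
    refine ⟨ε', lt_min hε₁ hδ, fun v => g (ψ v) * s v, ?_, ?_⟩
    · intro v hv
      have hv₁ : v ∈ ball w₀ ε₁ := ball_subset_ball (min_le_left _ _) hv
      have hvH : v ∈ H := hball₁ hv₁
      have hψv : ψ v ∈ ball (ψ w₀) ε := hδψ (mem_ball.1 (ball_subset_ball (min_le_right _ _) hv))
      have e1 : DifferentiableAt ℂ (fun v => g (ψ v)) v :=
        (hgd.differentiableAt (isOpen_ball.mem_nhds hψv)).comp v (hψdiff.differentiableAt (hHo.mem_nhds hvH))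
      exact (e1.mul (hsd.differentiableAt (isOpen_ball.mem_nhds hv₁))).differentiableWithinAt
    · intro v hv
      have hv₁ : v ∈ ball w₀ ε₁ := ball_subset_ball (min_le_left _ _) hv
      have hψv : ψ v ∈ ball (ψ w₀) ε := hδψ (mem_ball.1 (ball_subset_ball (min_le_right _ _) hv))
      rw [hq'def]
      simp only
      rw [hg (ψ v) hψv, mul_pow, hs v hv₁]
  /- (hsqb') branching at `b'` -/
  have hsqb' : ∃ ε > 0, ∃ k : ℂ → ℂ, DifferentiableOn ℂ k (ball b' ε \ {b'}) ∧
      ∀ w ∈ ball b' ε \ {b'}, (w - b') * q' w = k w ^ 2 := by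
    obtain ⟨ε, hε, k, hkd, hk⟩ := hsqb
    -- the holomorphic function `m = ψ' / dslope ψ b'` with `m(b') = 1`
    set m : ℂ → ℂ := fun w => deriv ψ w / dslope ψ b' w with hmdef
    have hdsd : DifferentiableOn ℂ (dslope ψ b') H :=
      (Complex.differentiableOn_dslope (hHo.mem_nhds hb'H)).2 hψdiff
    have hdsb : dslope ψ b' b' = deriv ψ b' := dslope_same _ _
    have hds_ne : ∀ w ∈ H, dslope ψ b' w ≠ 0 := by
      intro w hw
      by_cases hwb : w = b'
      · rw [hwb, hdsb]; exact hψ'0 b' hb'H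
      · rw [dslope_of_ne _ hwb, slope_def_field, hψb]
        refine div_ne_zero (sub_ne_zero.2 fun h => hwb ?_) (sub_ne_zero.2 hwb)
        exact hψinj hw hb'H (h.trans hψb.symm)
    have hmd : DifferentiableOn ℂ m H := hψ'd.div hdsd hds_ne
    have hmb : m b' = 1 := by rw [hmdef]; simp only; rw [hdsb, div_self (hψ'0 b' hb'H)]
    obtain ⟨ε₁, hε₁, hball₁, t, htd, ht⟩ := exists_ball_sq_eq_of_ne_zero hHo hmd hb'H (by rw [hmb]; exact one_ne_zero)
    obtain ⟨δ, hδ, hδψ⟩ := Metric.continuousAt_iff.1 (hψdiff.differentiableAt (hHo.mem_nhds hb'H)).continuousAt ε hε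
    set ε' : ℝ := min ε₁ δ with hε'
    refine ⟨ε', lt_min hε₁ hδ, fun w => t w * k (ψ w), ?_, ?_⟩
    · intro w hw
      have hw₁ : w ∈ ball b' ε₁ := ball_subset_ball (min_le_left _ _) hw.1
      have hwH : w ∈ H := hball₁ hw₁
      have hψw : ψ w ∈ ball b ε \ {b} := by
        refine ⟨?_, fun h => hw.2 ?_⟩
        · have := hδψ (mem_ball.1 (ball_subset_ball (min_le_right _ _) hw.1))
          rwa [hψb] at this
        · exact hψinj hwH hb'H ((mem_singleton_iff.1 h).trans hψb.symm)
      have e1 : DifferentiableAt ℂ (fun w => k (ψ w)) w :=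
        (hkd.differentiableAt ((isOpen_ball.sdiff isClosed_singleton).mem_nhds hψw)).comp w
          (hψdiff.differentiableAt (hHo.mem_nhds hwH))
      exact ((htd.differentiableAt (isOpen_ball.mem_nhds hw₁)).mul e1).differentiableWithinAt
    · intro w hw
      have hw₁ : w ∈ ball b' ε₁ := ball_subset_ball (min_le_left _ _) hw.1
      have hwH : w ∈ H := hball₁ hw₁
      have hwb : w ≠ b' := hw.2
      have hψw : ψ w ∈ ball b ε \ {b} := by
        refine ⟨?_, fun h => hw.2 ?_⟩
        · have := hδψ (mem_ball.1 (ball_subset_ball (min_le_right _ _) hw.1))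
          rwa [hψb] at this
        · exact hψinj hwH hb'H ((mem_singleton_iff.1 h).trans hψb.symm)
      have hkw := hk (ψ w) hψw
      have hds : dslope ψ b' w = (ψ w - b) / (w - b') := by rw [dslope_of_ne _ hwb, slope_def_field, hψb]
      have hwb' : w - b' ≠ 0 := sub_ne_zero.2 hwb
      have hψwb : ψ w - b ≠ 0 := sub_ne_zero.2 hψw.2
      rw [mul_pow, ht w hw₁, ← hkw, hmdef, hq'def]
      simp only
      rw [hds]
      field_simp
  /- (hh') the chain rule -/
  have hh' : ∀ w ∈ H \ {a', b'}, HasFDerivAt h' (reMul (q' w)) w := by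
    intro w hw
    have hwH : w ∈ H := hw.1
    have e := (hh (ψ w) (hψD w hw)).comp w ((hψd w hwH).hasFDerivAt.restrictScalars ℝ)
    rw [reMul_comp_toSpanSingleton, ← hψ' w hwH] at e
    exact e
  /- (h1') boundary values -/
  have h1' : ∀ ε > 0, ∃ K ⊆ H, IsCompact K ∧ ∀ w ∈ H \ K, |h' w| < ε := by
    intro ε hε
    obtain ⟨K, hKΩ, hK, hKh⟩ := h1 ε hε
    refine ⟨φ '' K, fun _ ⟨z, hz, hzw⟩ => hzw ▸ hφΩ z (hKΩ hz),
      hK.image_of_continuousOn (hφ.1.continuousOn.mono hKΩ), fun w hw => ?_⟩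
    have hzK : ψ w ∉ K := fun h => hw.2 ⟨ψ w, h, hφψ w hw.1⟩
    exact hKh (ψ w) ⟨hψH w hw.1, hzK⟩
  /- (h2') the sign condition -/
  have h2' : ∀ (x₀ : ℝ) (r : ℝ), 0 < r → ∃ w ∈ H, dist w x₀ < r ∧ h' w ≤ 0 := by
    intro x₀ r hr
    obtain ⟨z, hz, hzd, hzh⟩ := h2 x₀ r hr
    refine ⟨φ z, hφΩ z hz, hzd, ?_⟩
    rw [hh'def]
    simp only
    rwa [hψφ z hz]
  /- (h3') lower bound near `b'` -/
  have h3' : ∃ r > 0, ∃ M : ℝ, ∀ w ∈ ball b' r \ {b'}, w ∈ H → M ≤ h' w := by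
    obtain ⟨r, hr, M, hM⟩ := h3
    obtain ⟨δ, hδ, hδψ⟩ := Metric.continuousAt_iff.1 (hψdiff.differentiableAt (hHo.mem_nhds hb'H)).continuousAt r hr
    refine ⟨δ, hδ, M, fun w hw hwH => hM (ψ w) ⟨?_, fun h => hw.2 ?_⟩ (hψH w hwH)⟩
    · have := hδψ (mem_ball.1 hw.1)
      rwa [hψb] at this
    · exact hψinj hwH hb'H ((mem_singleton_iff.1 h).trans hψb.symm)
  /- (h4') the normalisation at `a'` -/
  have h4' : Tendsto (fun w => (w - a') * q' w) (𝓝[≠] a') (𝓝 1) := by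
    -- `ψ → a` within the punctured neighbourhoods
    have hψa_t : Tendsto ψ (𝓝[≠] a') (𝓝[≠] a) := by
      have hc : Tendsto ψ (𝓝 a') (𝓝 a) := by
        have := (hψdiff.differentiableAt (hHo.mem_nhds ha'H)).continuousAt.tendsto
        rwa [hψa] at this
      refine tendsto_nhdsWithin_of_tendsto_nhds_of_eventually_within _ (hc.mono_left nhdsWithin_le_nhds) ?_
      filter_upwards [mem_nhdsWithin_of_mem_nhds (hHo.mem_nhds ha'H), self_mem_nhdsWithin] with w hwH hw
      intro h
      exact hw (hψinj hwH ha'H ((mem_singleton_iff.1 h).trans hψa.symm))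
    have hA : Tendsto (fun w => (ψ w - a) * q (ψ w)) (𝓝[≠] a') (𝓝 1) := h4.comp hψa_t
    -- `ψ'/dslope ψ a' → 1`
    have hdsd : DifferentiableOn ℂ (dslope ψ a') H :=
      (Complex.differentiableOn_dslope (hHo.mem_nhds ha'H)).2 hψdiff
    have hB : Tendsto (fun w => deriv ψ w / dslope ψ a' w) (𝓝[≠] a') (𝓝 1) := by
      have h1 : Tendsto (deriv ψ) (𝓝 a') (𝓝 (deriv ψ a')) :=
        (hψ'd.differentiableAt (hHo.mem_nhds ha'H)).continuousAt.tendsto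
      have h2 : Tendsto (dslope ψ a') (𝓝 a') (𝓝 (deriv ψ a')) := by
        have := (hdsd.differentiableAt (hHo.mem_nhds ha'H)).continuousAt.tendsto
        rwa [dslope_same] at this
      have h3 : Tendsto (fun w => deriv ψ w / dslope ψ a' w) (𝓝[≠] a') (𝓝 (deriv ψ a' / deriv ψ a')) :=
        (h1.div h2 (hψ'0 a' ha'H)).mono_left nhdsWithin_le_nhds
      rwa [div_self (hψ'0 a' ha'H)] at h3
    have hAB := hA.mul hB
    rw [one_mul] at hAB
    refine hAB.congr' ?_
    filter_upwards [self_mem_nhdsWithin, mem_nhdsWithin_of_mem_nhds (hHo.mem_nhds ha'H)] with w hw hwH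
    have hwa : w - a' ≠ 0 := sub_ne_zero.2 hw
    have hψwa : ψ w - a ≠ 0 := sub_ne_zero.2 fun h => hw (hψinj hwH ha'H (h.trans hψa.symm))
    rw [dslope_of_ne _ hw, slope_def_field, hψa, hq'def]
    simp only
    field_simp
  /- the half-plane theorem and the pull-back -/
  have hmain := eqOn_spinorSqCHI_of_bvp ha'im hb'im hab' hq'd hsq' hsqb' hh' h1' h2' h3' h4'
  intro z hz
  have hzΩ : z ∈ Ω := hz.1
  have hne : z ≠ a ∧ z ≠ b := by simpa [not_or] using hz.2
  have hwD : φ z ∈ H \ {a', b'} := by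
    refine ⟨hφΩ z hzΩ, ?_⟩
    simp only [mem_insert_iff, mem_singleton_iff, not_or]
    exact ⟨fun h => hne.1 (hφ.2.injOn hzΩ ha h), fun h => hne.2 (hφ.2.injOn hzΩ hb h)⟩
  have h := hmain hwD
  rw [hq'def] at h
  simp only at h
  rw [hψφ z hzΩ, hψ' (φ z) hwD.1, hψφ z hzΩ] at h
  have hφ'z : deriv φ z ≠ 0 := hder z hzΩ
  unfold domainSpinorSq
  rw [← h]
  field_simp

/-- **The coefficient at the second branch point is `𝓑_Ω(a;b) = 𝓑_ℍ(φa;φb)`.** Under the hypotheses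
of `eqOn_domainSpinorSq_of_bvp`, `(z-b) q(z) → -bCHI(φ a, φ b)²` as `z → b` — the squared form of
CHI's (2.12) `f = ±i𝓑 (z-b)^{-1/2} + …` with the conformal invariance (2.13) of `𝓑`, the constant of
Thm 1.7 (`chi_freePlusTwoPoint_ratio`). [cite: ChelkakHonglerIzyurovAnnals2015, Def. 2.11 eq. (2.12), Remark 2.12 eq. (2.13), Prop. 3.9 with Remark 2.9 (i)] -/
theorem tendsto_mul_sub_right_of_bvp (hΩ : IsOpen Ω)
    (hφ : IsConformalBijection φ Ω UpperHalfPlane.upperHalfPlaneSet) (ha : a ∈ Ω) (hb : b ∈ Ω) (hab : a ≠ b)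
    {q : ℂ → ℂ} {h : ℂ → ℝ}
    (hq : DifferentiableOn ℂ q (Ω \ {a, b}))
    (hsq : ∀ z ∈ Ω \ {a, b}, ∃ ε > 0, ∃ g : ℂ → ℂ, DifferentiableOn ℂ g (ball z ε) ∧ ∀ w ∈ ball z ε, q w = g w ^ 2)
    (hsqb : ∃ ε > 0, ∃ k : ℂ → ℂ, DifferentiableOn ℂ k (ball b ε \ {b}) ∧
      ∀ w ∈ ball b ε \ {b}, (w - b) * q w = k w ^ 2)
    (hh : ∀ z ∈ Ω \ {a, b}, HasFDerivAt h (reMul (q z)) z)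
    (h1 : ∀ ε > 0, ∃ K ⊆ Ω, IsCompact K ∧ ∀ z ∈ Ω \ K, |h z| < ε)
    (h2 : ∀ (x₀ : ℝ) (r : ℝ), 0 < r → ∃ z ∈ Ω, dist (φ z) x₀ < r ∧ h z ≤ 0)
    (h3 : ∃ r > 0, ∃ M : ℝ, ∀ z ∈ ball b r \ {b}, z ∈ Ω → M ≤ h z)
    (h4 : Tendsto (fun z => (z - a) * q z) (𝓝[≠] a) (𝓝 1)) :
    Tendsto (fun z => q z * (z - b)) (𝓝[≠] b) (𝓝 (-((bCHI (φ a) (φ b) ^ 2 : ℝ) : ℂ))) := by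
  have hE := eqOn_domainSpinorSq_of_bvp hΩ hφ ha hb hab hq hsq hsqb hh h1 h2 h3 h4
  refine (tendsto_domainSpinorSq_mul_sub_right hΩ hφ ha hb hab).congr' ?_
  have hΩb : ∀ᶠ z in 𝓝[≠] b, z ∈ Ω := mem_nhdsWithin_of_mem_nhds (hΩ.mem_nhds hb)
  have hza : ∀ᶠ z in 𝓝[≠] b, z ≠ a := mem_nhdsWithin_of_mem_nhds (eventually_ne_nhds (Ne.symm hab))
  filter_upwards [hΩb, hza, self_mem_nhdsWithin] with z hz hza hzb
  have hzS : z ∈ Ω \ {a, b} := ⟨hz, by simp [hza, mem_compl_singleton_iff.1 hzb]⟩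
  rw [hE hzS]

/-- **The coefficient at the source is `𝒜_Ω(a;b) = ACHI φ a b`.** Under the hypotheses of
`eqOn_domainSpinorSq_of_bvp`, `((z-a) q(z) - 1)/(z-a) → 4 𝒜_Ω(a;b)` as `z → a` — the squared form of
CHI's Def. 2.11 `√(z-a) f = 1 + 2𝒜_Ω (z-a) + …` with the covariance rule of Remark 2.12, the
constant of Thm 1.5 (`chi_plusTwoPoint_diagLogDerivative`). [cite: ChelkakHonglerIzyurovAnnals2015, Def. 2.11 eq. (2.11), Remark 2.12, Prop. 3.9 with Remark 2.9 (i)] -/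
theorem tendsto_slope_mul_sub_left_of_bvp (hΩ : IsOpen Ω)
    (hφ : IsConformalBijection φ Ω UpperHalfPlane.upperHalfPlaneSet) (ha : a ∈ Ω) (hb : b ∈ Ω) (hab : a ≠ b)
    {q : ℂ → ℂ} {h : ℂ → ℝ}
    (hq : DifferentiableOn ℂ q (Ω \ {a, b}))
    (hsq : ∀ z ∈ Ω \ {a, b}, ∃ ε > 0, ∃ g : ℂ → ℂ, DifferentiableOn ℂ g (ball z ε) ∧ ∀ w ∈ ball z ε, q w = g w ^ 2)
    (hsqb : ∃ ε > 0, ∃ k : ℂ → ℂ, DifferentiableOn ℂ k (ball b ε \ {b}) ∧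
      ∀ w ∈ ball b ε \ {b}, (w - b) * q w = k w ^ 2)
    (hh : ∀ z ∈ Ω \ {a, b}, HasFDerivAt h (reMul (q z)) z)
    (h1 : ∀ ε > 0, ∃ K ⊆ Ω, IsCompact K ∧ ∀ z ∈ Ω \ K, |h z| < ε)
    (h2 : ∀ (x₀ : ℝ) (r : ℝ), 0 < r → ∃ z ∈ Ω, dist (φ z) x₀ < r ∧ h z ≤ 0)
    (h3 : ∃ r > 0, ∃ M : ℝ, ∀ z ∈ ball b r \ {b}, z ∈ Ω → M ≤ h z)
    (h4 : Tendsto (fun z => (z - a) * q z) (𝓝[≠] a) (𝓝 1)) :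
    Tendsto (fun z => (q z * (z - a) - 1) / (z - a)) (𝓝[≠] a) (𝓝 (4 * ACHI φ a b)) := by
  have hE := eqOn_domainSpinorSq_of_bvp hΩ hφ ha hb hab hq hsq hsqb hh h1 h2 h3 h4
  have hD := hasDerivAt_domainSpinorSqMulLeft hΩ hφ ha hb hab
  rw [hasDerivAt_iff_tendsto_slope] at hD
  refine hD.congr' ?_
  have hΩa : ∀ᶠ z in 𝓝[≠] a, z ∈ Ω := mem_nhdsWithin_of_mem_nhds (hΩ.mem_nhds ha)
  have hzb : ∀ᶠ z in 𝓝[≠] a, z ≠ b := mem_nhdsWithin_of_mem_nhds (eventually_ne_nhds hab)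
  filter_upwards [hΩa, hzb, self_mem_nhdsWithin] with z hz hzb hza
  have hza' : z ≠ a := mem_compl_singleton_iff.1 hza
  have hzS : z ∈ Ω \ {a, b} := ⟨hz, by simp [hza', hzb]⟩
  rw [slope_def_field, domainSpinorSqMulLeft_self hΩ hφ ha hb hab, ← domainSpinorSq_mul_sub_left hφ ha hz hza',
    hE hzS]

/-- **The renormalised limit vanishes, on a general simply connected domain (CHI15 §3.4).**
Transport of `eq_zero_of_bvp_bounded` along the chart `φ : Ω → ℍ`: if `q` is holomorphic on
`Ω ∖ {a,b}` with single-valued real primitive `h` (`dh = Re(q dz)`), (1) `h → 0` at `∂Ω`,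
(2) every prime-end half-disc `{|φ - x₀| < r} ∩ Ω` contains a point with `h ≤ 0`, (3) `h` is bounded
below near `b` and (4') `h` is bounded near `a`, then `h ≡ 0` and `q ≡ 0` on `Ω ∖ {a,b}` — the
contradiction ending the proof of Thm 2.16 for the renormalised functions `(M_δ(ε))⁻¹ H_δ`.
[cite: ChelkakHonglerIzyurovAnnals2015, §3.4, proof of Thm 2.16 ("this yields h̃ ≡ 0, which is a contradiction")] -/
theorem eqOn_zero_of_bvp_bounded (hΩ : IsOpen Ω)
    (hφ : IsConformalBijection φ Ω UpperHalfPlane.upperHalfPlaneSet) (ha : a ∈ Ω) (hb : b ∈ Ω) (hab : a ≠ b)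
    {q : ℂ → ℂ} {h : ℂ → ℝ}
    (hq : DifferentiableOn ℂ q (Ω \ {a, b}))
    (hh : ∀ z ∈ Ω \ {a, b}, HasFDerivAt h (reMul (q z)) z)
    (h1 : ∀ ε > 0, ∃ K ⊆ Ω, IsCompact K ∧ ∀ z ∈ Ω \ K, |h z| < ε)
    (h2 : ∀ (x₀ : ℝ) (r : ℝ), 0 < r → ∃ z ∈ Ω, dist (φ z) x₀ < r ∧ h z ≤ 0)
    (h3 : ∃ r > 0, ∃ M : ℝ, ∀ z ∈ ball b r \ {b}, z ∈ Ω → M ≤ h z)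
    (h4 : ∃ r > 0, ∃ M : ℝ, ∀ z ∈ ball a r \ {a}, z ∈ Ω → |h z| ≤ M) :
    EqOn h 0 (Ω \ {a, b}) ∧ EqOn q 0 (Ω \ {a, b}) := by
  set H : Set ℂ := UpperHalfPlane.upperHalfPlaneSet with hHdef
  have hHo : IsOpen H := UpperHalfPlane.isOpen_upperHalfPlaneSet
  obtain ⟨hbijψ, hψφ, hφψ, hder, hψder⟩ := invFunOn_conformal hΩ hφ
  set ψ : ℂ → ℂ := Function.invFunOn φ Ω with hψdef
  have hψH : ∀ w ∈ H, ψ w ∈ Ω := fun w hw => hbijψ.mapsTo hw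
  have hφΩ : ∀ z ∈ Ω, φ z ∈ H := fun z hz => hφ.2.mapsTo hz
  have hψd : ∀ w ∈ H, HasDerivAt ψ (deriv φ (ψ w))⁻¹ w := fun w hw => by
    have := hψder (ψ w) (hψH w hw)
    rwa [hφψ w hw] at this
  have hψdiff : DifferentiableOn ℂ ψ H := fun w hw => (hψd w hw).differentiableAt.differentiableWithinAt
  have hψan : AnalyticOnNhd ℂ ψ H := hψdiff.analyticOnNhd hHo
  have hψ' : ∀ w ∈ H, deriv ψ w = (deriv φ (ψ w))⁻¹ := fun w hw => (hψd w hw).deriv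
  have hψ'0 : ∀ w ∈ H, deriv ψ w ≠ 0 := fun w hw => by
    rw [hψ' w hw]; exact inv_ne_zero (hder _ (hψH w hw))
  have hψ'd : DifferentiableOn ℂ (deriv ψ) H := (hψan.deriv).differentiableOn
  have hψinj : InjOn ψ H := hbijψ.injOn
  set a' : ℂ := φ a with ha'
  set b' : ℂ := φ b with hb'
  have ha'H : a' ∈ H := hφΩ a ha
  have hb'H : b' ∈ H := hφΩ b hb
  have ha'im : 0 < a'.im := ha'H
  have hb'im : 0 < b'.im := hb'H
  have hab' : a' ≠ b' := fun h => hab (hφ.2.injOn ha hb h)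
  have hψa : ψ a' = a := hψφ a ha
  have hψb : ψ b' = b := hψφ b hb
  have hψD : ∀ w ∈ H \ {a', b'}, ψ w ∈ Ω \ {a, b} := by
    intro w hw
    have hwH : w ∈ H := hw.1
    have hne : w ≠ a' ∧ w ≠ b' := by simpa [not_or] using hw.2
    refine ⟨hψH w hwH, ?_⟩
    simp only [mem_insert_iff, mem_singleton_iff, not_or]
    refine ⟨fun h => hne.1 ?_, fun h => hne.2 ?_⟩
    · rw [← hφψ w hwH, h]
    · rw [← hφψ w hwH, h]
  have hφD : ∀ z ∈ Ω \ {a, b}, φ z ∈ H \ {a', b'} := by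
    intro z hz
    have hzΩ : z ∈ Ω := hz.1
    have hne : z ≠ a ∧ z ≠ b := by simpa [not_or] using hz.2
    refine ⟨hφΩ z hzΩ, ?_⟩
    simp only [mem_insert_iff, mem_singleton_iff, not_or]
    exact ⟨fun h => hne.1 (hφ.2.injOn hzΩ ha h), fun h => hne.2 (hφ.2.injOn hzΩ hb h)⟩
  set q' : ℂ → ℂ := fun w => q (ψ w) * deriv ψ w with hq'def
  set h' : ℂ → ℝ := fun w => h (ψ w) with hh'def
  have hq'd : DifferentiableOn ℂ q' (H \ {a', b'}) := by
    intro w hw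
    have hwH : w ∈ H := hw.1
    have hzD := hψD w hw
    have hΩo : IsOpen (Ω \ {a, b}) := hΩ.sdiff (Set.toFinite {a, b}).isClosed
    have e1 : DifferentiableAt ℂ (fun w => q (ψ w)) w :=
      (hq.differentiableAt (hΩo.mem_nhds hzD)).comp w (hψdiff.differentiableAt (hHo.mem_nhds hwH))
    exact (e1.mul (hψ'd.differentiableAt (hHo.mem_nhds hwH))).differentiableWithinAt
  have hh' : ∀ w ∈ H \ {a', b'}, HasFDerivAt h' (reMul (q' w)) w := by
    intro w hw
    have hwH : w ∈ H := hw.1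
    have e := (hh (ψ w) (hψD w hw)).comp w ((hψd w hwH).hasFDerivAt.restrictScalars ℝ)
    rw [reMul_comp_toSpanSingleton, ← hψ' w hwH] at e
    exact e
  have h1' : ∀ ε > 0, ∃ K ⊆ H, IsCompact K ∧ ∀ w ∈ H \ K, |h' w| < ε := by
    intro ε hε
    obtain ⟨K, hKΩ, hK, hKh⟩ := h1 ε hε
    refine ⟨φ '' K, fun _ ⟨z, hz, hzw⟩ => hzw ▸ hφΩ z (hKΩ hz),
      hK.image_of_continuousOn (hφ.1.continuousOn.mono hKΩ), fun w hw => ?_⟩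
    have hzK : ψ w ∉ K := fun h => hw.2 ⟨ψ w, h, hφψ w hw.1⟩
    exact hKh (ψ w) ⟨hψH w hw.1, hzK⟩
  have h2' : ∀ (x₀ : ℝ) (r : ℝ), 0 < r → ∃ w ∈ H, dist w x₀ < r ∧ h' w ≤ 0 := by
    intro x₀ r hr
    obtain ⟨z, hz, hzd, hzh⟩ := h2 x₀ r hr
    refine ⟨φ z, hφΩ z hz, hzd, ?_⟩
    rw [hh'def]
    simp only
    rwa [hψφ z hz]
  have h3' : ∃ r > 0, ∃ M : ℝ, ∀ w ∈ ball b' r \ {b'}, w ∈ H → M ≤ h' w := by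
    obtain ⟨r, hr, M, hM⟩ := h3
    obtain ⟨δ, hδ, hδψ⟩ :=
      Metric.continuousAt_iff.1 (hψdiff.differentiableAt (hHo.mem_nhds hb'H)).continuousAt r hr
    refine ⟨δ, hδ, M, fun w hw hwH => hM (ψ w) ⟨?_, fun h => hw.2 ?_⟩ (hψH w hwH)⟩
    · have := hδψ (mem_ball.1 hw.1)
      rwa [hψb] at this
    · exact hψinj hwH hb'H ((mem_singleton_iff.1 h).trans hψb.symm)
  have h4' : ∃ r > 0, ∃ M : ℝ, ∀ w ∈ ball a' r \ {a'}, w ∈ H → |h' w| ≤ M := by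
    obtain ⟨r, hr, M, hM⟩ := h4
    obtain ⟨δ, hδ, hδψ⟩ :=
      Metric.continuousAt_iff.1 (hψdiff.differentiableAt (hHo.mem_nhds ha'H)).continuousAt r hr
    refine ⟨δ, hδ, M, fun w hw hwH => hM (ψ w) ⟨?_, fun h => hw.2 ?_⟩ (hψH w hwH)⟩
    · have := hδψ (mem_ball.1 hw.1)
      rwa [hψa] at this
    · exact hψinj hwH ha'H ((mem_singleton_iff.1 h).trans hψa.symm)
  obtain ⟨hh0, hq0⟩ := eq_zero_of_bvp_bounded ha'im hb'im hab' hq'd hh' h1' h2' h3' h4'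
  refine ⟨fun z hz => ?_, fun z hz => ?_⟩
  · have e := hh0 (hφD z hz)
    rw [hh'def] at e
    simp only [Pi.zero_apply] at e ⊢
    rwa [hψφ z hz.1] at e
  · have e := hq0 (hφD z hz)
    rw [hq'def] at e
    simp only [Pi.zero_apply, mul_eq_zero] at e ⊢
    rcases e with e | e
    · rwa [hψφ z hz.1] at e
    · exact absurd e (hψ'0 _ (hφD z hz).1)

end Transport

/-! ### Prop. 3.9 (4) ⇒ (2.8): the normalisation at the source from the boundedness of `h^{(a)}` -/

/-- **CHI15 Prop. 3.9, property (4) ⇒ (2.8).** Let `G` be holomorphic on a punctured disc about `a`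
(the single-valued function `√(z-a)·f̃`, whose square is `(z-a)f̃²`) and let the real function
`h^{(a)}` with `dh^{(a)} = Re(u dz)`, `u = (G-1)²/(z-a) = (f̃ - f_{ℂ,a})²` ("`h^{(a)} := Re ∫ (f - f_{ℂ,a})²`",
`f_{ℂ,a} = 1/√(z-a)`), be bounded on the punctured disc (property (4): "`h^{(a)}` is single-valued and
bounded in a neighborhood of `a`"). Then `G → 1`, i.e. `√(z-a) f̃ → 1` ((2.8): "(3),(4) imply (2.7),(2.8)
by differentiating and taking the square root"): by Bôcher's theorem `u` has a simple pole with real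
residue `c ≤ 0` and `h^{(a)} = c log|z-a| + O(1)`, and the upper bound forces `c = 0`, so `u` is
holomorphic at `a` and `(G-1)² = (z-a)u → 0`. In particular hypothesis (4) of
`eqOn_domainSpinorSq_of_bvp` holds for `q = G²/(z-a)`. [cite: ChelkakHonglerIzyurovAnnals2015, Prop. 3.9 ((4) and its proof: "(3),(4) imply (2.7),(2.8)")] -/
theorem tendsto_one_of_re_primitive_bounded {G : ℂ → ℂ} {hₐ : ℂ → ℝ} {a : ℂ} {R M : ℝ} (hR : 0 < R)
    (hG : DifferentiableOn ℂ G (ball a R \ {a}))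
    (hh : ∀ z ∈ ball a R \ {a}, HasFDerivAt hₐ (reMul ((G z - 1) ^ 2 / (z - a))) z)
    (hM : ∀ z ∈ ball a R \ {a}, |hₐ z| ≤ M) :
    Tendsto G (𝓝[≠] a) (𝓝 1) := by
  set D : Set ℂ := ball a R \ {a} with hD
  set u : ℂ → ℂ := fun z => (G z - 1) ^ 2 / (z - a) with hu
  have hud : DifferentiableOn ℂ u D :=
    ((hG.sub_const 1).pow 2).div (by fun_prop) fun z hz => sub_ne_zero.2 hz.2
  obtain ⟨g, Γ, hgd, -, hug, -⟩ := exists_holomorphic_of_re_primitive_bounded hR hud hh hM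
  -- `u = g` is holomorphic at `a`, so `(z-a)u → 0`
  have hDev : ∀ᶠ z in 𝓝[≠] a, z ∈ D := by
    filter_upwards [mem_nhdsWithin_of_mem_nhds (ball_mem_nhds a hR), self_mem_nhdsWithin] with z h1 h2
    exact ⟨h1, h2⟩
  have hu0 : Tendsto (fun z => (z - a) * u z) (𝓝[≠] a) (𝓝 0) := by
    have hg : Tendsto g (𝓝[≠] a) (𝓝 (g a)) :=
      ((hgd.differentiableAt (ball_mem_nhds a hR)).continuousAt.tendsto).mono_left nhdsWithin_le_nhds
    have hz : Tendsto (fun z : ℂ => z - a) (𝓝[≠] a) (𝓝 0) := by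
      have hc' : Continuous fun z : ℂ => z - a := by fun_prop
      have := (hc'.tendsto a).mono_left (nhdsWithin_le_nhds (s := ({a}ᶜ : Set ℂ)))
      rwa [sub_self] at this
    have := hz.mul hg
    rw [zero_mul] at this
    refine this.congr' ?_
    filter_upwards [hDev] with z hzD
    rw [hug z hzD]
  -- `(G-1)² = (z-a)u → 0`, hence `G → 1`
  have hG1 : Tendsto (fun z => (G z - 1) ^ 2) (𝓝[≠] a) (𝓝 0) := by
    refine hu0.congr' ?_
    filter_upwards [hDev] with z hzD
    have : z - a ≠ 0 := sub_ne_zero.2 hzD.2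
    rw [hu]
    field_simp
  have hnorm : Tendsto (fun z => ‖G z - 1‖) (𝓝[≠] a) (𝓝 0) := by
    have hsq : Tendsto (fun z => ‖G z - 1‖ ^ 2) (𝓝[≠] a) (𝓝 0) := by
      have := hG1.norm
      rw [norm_zero] at this
      exact this.congr fun z => by rw [norm_pow]
    have := (Real.continuous_sqrt.tendsto 0).comp hsq
    rw [Real.sqrt_zero] at this
    exact this.congr fun z => by simp [Real.sqrt_sq (norm_nonneg _)]
  have := tendsto_zero_iff_norm_tendsto_zero.2 hnorm
  have h1 := this.add_const (1 : ℂ)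
  simp only [sub_add_cancel, zero_add] at h1
  exact h1

/-- **Prop. 3.9 ⇒ Remark 2.9 (i), with property (4) as printed.** The variant of
`eqOn_domainSpinorSq_of_bvp` in which the normalisation at the source is CHI's property (4)
itself: near `a`, `(z-a) q = G²` for a holomorphic `G` on a punctured disc (the single-valued
`√(z-a)·f̃`) and `h^{(a)} = Re ∫ (G-1)²/(z-a) dz = Re ∫ (f̃ - f_{ℂ,a})²` is single-valued and bounded;
`tendsto_one_of_re_primitive_bounded` converts it into `(z-a)q → 1`.
[cite: ChelkakHonglerIzyurovAnnals2015, Prop. 3.9 ((1)–(4) ⇒ (2.6)–(2.8)) with Remark 2.9 (i)–(ii)] -/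
theorem eqOn_domainSpinorSq_of_bvp_of_bounded {Ω : Set ℂ} {φ : ℂ → ℂ} {a b : ℂ} (hΩ : IsOpen Ω)
    (hφ : IsConformalBijection φ Ω UpperHalfPlane.upperHalfPlaneSet) (ha : a ∈ Ω) (hb : b ∈ Ω) (hab : a ≠ b)
    {q : ℂ → ℂ} {h : ℂ → ℝ}
    (hq : DifferentiableOn ℂ q (Ω \ {a, b}))
    (hsq : ∀ z ∈ Ω \ {a, b}, ∃ ε > 0, ∃ g : ℂ → ℂ, DifferentiableOn ℂ g (ball z ε) ∧ ∀ w ∈ ball z ε, q w = g w ^ 2)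
    (hsqb : ∃ ε > 0, ∃ k : ℂ → ℂ, DifferentiableOn ℂ k (ball b ε \ {b}) ∧
      ∀ w ∈ ball b ε \ {b}, (w - b) * q w = k w ^ 2)
    (hh : ∀ z ∈ Ω \ {a, b}, HasFDerivAt h (reMul (q z)) z)
    (h1 : ∀ ε > 0, ∃ K ⊆ Ω, IsCompact K ∧ ∀ z ∈ Ω \ K, |h z| < ε)
    (h2 : ∀ (x₀ : ℝ) (r : ℝ), 0 < r → ∃ z ∈ Ω, dist (φ z) x₀ < r ∧ h z ≤ 0)
    (h3 : ∃ r > 0, ∃ M : ℝ, ∀ z ∈ ball b r \ {b}, z ∈ Ω → M ≤ h z)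
    (h4 : ∃ R > 0, ∃ G : ℂ → ℂ, ∃ hₐ : ℂ → ℝ, ∃ M : ℝ, DifferentiableOn ℂ G (ball a R \ {a}) ∧
      (∀ z ∈ ball a R \ {a}, (z - a) * q z = G z ^ 2) ∧
      (∀ z ∈ ball a R \ {a}, HasFDerivAt hₐ (reMul ((G z - 1) ^ 2 / (z - a))) z) ∧
      ∀ z ∈ ball a R \ {a}, |hₐ z| ≤ M) :
    EqOn q (domainSpinorSq φ a b) (Ω \ {a, b}) := by
  obtain ⟨R, hR, G, hₐ, M, hGd, hGq, hhₐ, hM⟩ := h4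
  refine eqOn_domainSpinorSq_of_bvp hΩ hφ ha hb hab hq hsq hsqb hh h1 h2 h3 ?_
  have hG2 := (tendsto_one_of_re_primitive_bounded hR hGd hhₐ hM).pow 2
  rw [one_pow] at hG2
  refine hG2.congr' ?_
  filter_upwards [mem_nhdsWithin_of_mem_nhds (ball_mem_nhds a hR), self_mem_nhdsWithin] with z hz1 hz2
  exact (hGq z ⟨hz1, hz2⟩).symm

end Literature.Probability.LatticeModels

end
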